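import Summits.BirchSwinnertonDyer.Rank2Observatory.ZywinaFamilyPAdicHeights
import Literature.NumberTheory.EllipticCurves.Zywina2025AdmissibleClasses
import HarnessLib

/-!
# The regulator door (cell bsd-rank2, S0-DOORS §4 N3, D1): infinitely many `E/ℚ` of rank `2`
# satisfying Schneider's conjecture at `p` — modulo Tao–Ziegler only

Cell-side file (cell bsd-rank2; the D1 door of seats p2 gen 2–3, `HOME/p2/PADIC-R2-G3.md` §0,
`PadicRank2SketchG3` §E), now a tree theorem modulo the single Literature named fact
`Literature.NumberTheory.Sieve.TaoZiegler2008_polynomialProgressions` (Tao–Ziegler 2008 Thm 1.3):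

* `norm_padicLog_natCast` — `‖log_p m‖_p = ‖m^{p-1} - 1‖_p` (`p` odd, `p ∤ m`);
* `norm_sq_lt_norm_padicLog_div_two` — on the residue class `m ≡ m₁ (mod p^K)`, `p^K ∣ n`
  (`K ≥ 1`) with `p^K ∤ m₁^{p-1} - 1` (`μ(m₁) < K`): `‖n‖_p² < ‖½ log_p m‖_p`;
* `schneiderConjecture_of_mem_zywinaClass` — every member `(m, n)` of
  `zywinaClass p K m₁ M` (`p ≥ 5`, `K ≥ 1`, `p ∤ m₁`, `p^K ∤ m₁^{p-1} - 1`) has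
  `SchneiderConjecture D` for every canonical `p`-adic height datum `D` of `E_{m,n}`
  (THEOREM R\* (iii), `Rank2Observatory.ZywinaFamily.schneiderConjecture`);
* `infinite_rankTwo_schneiderConjecture` — Tao–Ziegler (`zywinaClass_infinite`) ⇒ the set of
  `W : WeierstrassCurve ℚ` with `W.IsElliptic ∧ W.mordellWeilRank = 2 ∧ ∀ D canonical,
  SchneiderConjecture D` is infinite; `infinite_rankTwo_schneiderConjecture_at_five` — the explicit
  instance `p = 5`, `K = 2`, `m₁ = 11`, `M = 1` (`25 ∤ 11⁴ - 1 = 14640`);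
* `infinite_setOf_j_rankTwo_schneiderConjecture` / `…_at_five` — the same door COUNTED BY
  `j`-INVARIANT (i.e. up to `ℚ̄`-isomorphism, as Zywina's Thm 1.1 is printed): distinct admissible
  pairs have distinct `j`-invariants (`eq_of_j_eq`, Zywina Lemma 4.1), so the set of `j ∈ ℚ` carried
  by some `E/ℚ` of rank `2` satisfying Schneider's conjecture at `p` for every canonical datum is
  infinite (referee R-12b: the model-level statements above count Weierstrass MODELS).

B1 honesty: this is the REGULATOR door (node N3, inside the Schneider barrier): rank `2` comes from
Zywina's `2`-descent, Schneider from `p`-adic height algebra; no clause reads the analytic rank and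
nothing here bears on `r_an = 2 ⇒ r_MW = 2` (S0 not crossed).
-/

noncomputable section

open scoped Classical
open Literature.NumberTheory.EllipticCurves Literature.NumberTheory.EllipticCurves.Zywina2025
open Literature.NumberTheory.Sieve
open WeierstrassCurve

namespace Summit.BirchSwinnertonDyer.Rank2

section Lead

variable {p : ℕ} [hp : Fact p.Prime]

/-- **`‖log_p m‖_p = ‖m^{p-1} - 1‖_p`** for `p` odd, `p ∤ m`: `log_p m = (p-1)⁻¹ log_p(m^{p-1})`,
`‖log_p y‖ = ‖1 - y‖` on principal units (`norm_padicLogSeries_eq`), `m^{p-1} ≡ 1 (mod p)`. -/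
theorem norm_padicLog_natCast (hp2 : p ≠ 2) {m : ℕ} (hpm : ¬ p ∣ m) :
    ‖padicLog p (m : ℚ_[p])‖ = ‖(m : ℚ_[p]) ^ (p - 1) - 1‖ := by
  have hcop : p.Coprime m := (Nat.Prime.coprime_iff_not_dvd hp.out).mpr hpm
  have hn1 : ‖(m : ℚ_[p])‖ = 1 := Padic.norm_natCast_eq_one_iff.mpr hcop
  have hm0 : (m : ℚ_[p]) ≠ 0 := by
    intro h; rw [h, norm_zero] at hn1; exact zero_ne_one hn1
  have h2 : ‖(2 : ℚ_[p])‖ = 1 := by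
    rw [show (2 : ℚ_[p]) = ((2 : ℕ) : ℚ_[p]) by norm_cast, Padic.norm_natCast_eq_one_iff]
    exact (Nat.coprime_primes hp.out Nat.prime_two).mpr hp2
  -- `m^{p-1}` is a principal unit
  have hF : ‖1 - (m : ℚ_[p]) ^ (p - 1)‖ < 1 := by
    have hcopZ : IsCoprime (m : ℤ) (p : ℤ) := by
      rw [Int.isCoprime_iff_gcd_eq_one, Int.gcd_natCast_natCast]; exact hcop.symm
    have hdvd : (p : ℤ) ∣ (1 - (m : ℤ) ^ (p - 1)) :=
      (Int.ModEq.pow_card_sub_one_eq_one hp.out hcopZ).dvd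
    have := Padic.norm_intCast_lt_one_iff.mpr hdvd
    simpa using this
  -- `(p - 1) • log m = log (m^{p-1})`
  have hpow : ∀ k : ℕ, padicLog p ((m : ℚ_[p]) ^ k) = k * padicLog p (m : ℚ_[p]) := by
    intro k
    induction k with
    | zero => simp [padicLog_one]
    | succ k ih =>
      rw [pow_succ, padicLog_mul_holds p (pow_ne_zero _ hm0) hm0, ih]; push_cast; ring
  -- `‖p - 1‖_p = 1` (also `Summit.BirchSwinnertonDyer.Rank1Residual.X2.norm_natCast_prime_sub_one`;
  -- re-derived inline to keep this cell's imports inside its own cone)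
  have hp1' : ‖(p : ℚ_[p]) - 1‖ = 1 := by
    have h : ‖1 - (1 - (p : ℚ_[p]))‖ < 1 := by simpa using Padic.norm_p_lt_one (p := p)
    have := norm_eq_one_of_norm_one_sub_lt h
    rwa [norm_sub_rev] at this
  have hp1 : ((p - 1 : ℕ) : ℚ_[p]) ≠ 0 := by
    have : ‖((p - 1 : ℕ) : ℚ_[p])‖ = 1 := by rw [Nat.cast_pred hp.out.pos]; exact hp1'
    intro h0; rw [h0, norm_zero] at this; exact zero_ne_one this
  have key : padicLog p (m : ℚ_[p]) = ((p - 1 : ℕ) : ℚ_[p])⁻¹ * padicLog p ((m : ℚ_[p]) ^ (p - 1)) := by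
    rw [hpow, ← mul_assoc, inv_mul_cancel₀ hp1, one_mul]
  rw [key, norm_mul, norm_inv, Nat.cast_pred hp.out.pos, hp1', inv_one,
    one_mul, padicLog_eq_padicLogSeries hF, norm_padicLogSeries_eq (by rwa [h2]), norm_sub_rev]

/-- **`‖n‖_p² < ‖½ log_p m‖_p` on a residue class:** `p` odd, `K ≥ 1`, `p^K ∣ n`,
`m ≡ m₁ (mod p^K)`, `p ∤ m₁`, `p^K ∤ m₁^{p-1} - 1` (i.e. `μ(m₁) < K`). -/
theorem norm_sq_lt_norm_padicLog_div_two (hp2 : p ≠ 2) {K m₁ m n : ℕ} (hK : 0 < K)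
    (hpm₁ : ¬ p ∣ m₁) (hμ : ¬ (p : ℤ) ^ K ∣ (m₁ : ℤ) ^ (p - 1) - 1) (hmod : m ≡ m₁ [MOD p ^ K])
    (hn : p ^ K ∣ n) :
    ‖(n : ℚ_[p])‖ ^ 2 < ‖padicLog p (m : ℚ_[p]) / 2‖ := by
  have h2 : ‖(2 : ℚ_[p])‖ = 1 := by
    rw [show (2 : ℚ_[p]) = ((2 : ℕ) : ℚ_[p]) by norm_cast, Padic.norm_natCast_eq_one_iff]
    exact (Nat.coprime_primes hp.out Nat.prime_two).mpr hp2
  have hmodZ : (m : ℤ) ≡ m₁ [ZMOD (p : ℤ) ^ K] := by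
    have := (Int.natCast_modEq_iff).mpr hmod
    push_cast at this
    exact this
  have hpm : ¬ p ∣ m := by
    intro hdiv
    apply hpm₁
    have h1 : (m : ℤ) ≡ m₁ [ZMOD (p : ℤ)] := hmodZ.of_dvd (dvd_pow_self (p : ℤ) hK.ne')
    have hm : (p : ℤ) ∣ (m : ℤ) := by exact_mod_cast hdiv
    have : (p : ℤ) ∣ (m₁ : ℤ) := by
      have := Int.dvd_sub hm (Int.ModEq.dvd h1.symm)
      simpa using this
    exact_mod_cast this
  -- `‖log_p m / 2‖ = ‖m^{p-1} - 1‖ > p^{-K}`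
  have hlog : (p : ℝ) ^ (-(K : ℤ)) < ‖padicLog p (m : ℚ_[p]) / 2‖ := by
    rw [norm_div, h2, div_one, norm_padicLog_natCast hp2 hpm,
      show (m : ℚ_[p]) ^ (p - 1) - 1 = (((m : ℤ) ^ (p - 1) - 1 : ℤ) : ℚ_[p]) by push_cast; ring,
      ← not_le, Padic.norm_int_le_pow_iff_dvd]
    intro hdvd
    apply hμ
    have hpow : (m : ℤ) ^ (p - 1) - 1 ≡ (m₁ : ℤ) ^ (p - 1) - 1 [ZMOD (p : ℤ) ^ K] :=
      (hmodZ.pow (p - 1)).sub_right 1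
    exact (Int.ModEq.dvd_iff hpow).mp hdvd
  -- `‖n‖² ≤ ‖n‖ ≤ p^{-K}`
  have hn1 : ‖(n : ℚ_[p])‖ ≤ (p : ℝ) ^ (-(K : ℤ)) := by
    rw [show (n : ℚ_[p]) = ((n : ℤ) : ℚ_[p]) by push_cast; rfl, Padic.norm_int_le_pow_iff_dvd]
    exact_mod_cast hn
  have hnle1 : ‖(n : ℚ_[p])‖ ≤ 1 := by simpa using norm_natCast_le_one (p := p) n
  calc ‖(n : ℚ_[p])‖ ^ 2 = ‖(n : ℚ_[p])‖ * ‖(n : ℚ_[p])‖ := sq _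
    _ ≤ 1 * ‖(n : ℚ_[p])‖ := by gcongr
    _ ≤ (p : ℝ) ^ (-(K : ℤ)) := by rw [one_mul]; exact hn1
    _ < _ := hlog

end Lead

section Door

variable {p : ℕ} [hp : Fact p.Prime]

/-- **Schneider's conjecture on a whole residue class** (THEOREM R\* (iii) + the congruence): for
`p ≥ 5`, `K ≥ 1`, `p ∤ m₁`, `p^K ∤ m₁^{p-1} - 1`, every member `(m, n) ∈ zywinaClass p K m₁ M` and
every canonical `p`-adic height datum `D` of `E_{m,n}`: `SchneiderConjecture D`. -/
theorem schneiderConjecture_of_mem_zywinaClass (hp5 : 5 ≤ p) {K m₁ M m n : ℕ} (hK : 0 < K)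
    (hpm₁ : ¬ p ∣ m₁) (hμ : ¬ (p : ℤ) ^ K ∣ (m₁ : ℤ) ^ (p - 1) - 1)
    (hmn : (m, n) ∈ zywinaClass p K m₁ M) (D : PAdicHeightData (zywinaCurve m n) p)
    (hD : D.IsCanonical) : SchneiderConjecture D := by
  obtain ⟨hadm, hmod, hdiv⟩ := hmn
  have hKn : p ^ K ∣ n := (Dvd.intro _ rfl : p ^ K ∣ p ^ K * M).trans hdiv
  have hpn : p ∣ n := (dvd_pow_self p hK.ne').trans hKn
  exact Rank2Observatory.ZywinaFamily.schneiderConjecture hadm hp5 hpn hD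
    (norm_sq_lt_norm_padicLog_div_two (by omega) hK hpm₁ hμ hmod hKn)

/-- `(m, n) ↦ E_{m,n}` is injective on `ℕ × ℕ` (coefficients `a₂ = -5q`, `a₄ = 4qr` determine
`q = m + 16n²`, `r = m + 25n²`, hence `n²` and `m`). -/
theorem zywinaCurve_injective :
    Function.Injective (fun q : ℕ × ℕ => zywinaCurve q.1 q.2) := by
  rintro ⟨m₁, n₁⟩ ⟨m₂, n₂⟩ h
  have h2 := congrArg WeierstrassCurve.a₂ h
  have h4 := congrArg WeierstrassCurve.a₄ h
  simp only [zywinaCurve] at h2 h4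
  have hq : (m₁ : ℚ) + 16 * (n₁ : ℚ) ^ 2 = m₂ + 16 * (n₂ : ℚ) ^ 2 := by linarith
  rw [hq] at h4
  have hm₁0 : (0 : ℚ) ≤ m₁ := Nat.cast_nonneg _
  have hm₂0 : (0 : ℚ) ≤ m₂ := Nat.cast_nonneg _
  have hn₁0 : (0 : ℚ) ≤ n₁ := Nat.cast_nonneg _
  have hn₂0 : (0 : ℚ) ≤ n₂ := Nat.cast_nonneg _
  by_cases h0 : (m₂ : ℚ) + 16 * (n₂ : ℚ) ^ 2 = 0
  · have hm₂ : (m₂ : ℚ) = 0 := by nlinarith [sq_nonneg (n₂ : ℚ)]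
    have hn₂ : (n₂ : ℚ) = 0 := by nlinarith [sq_nonneg (n₂ : ℚ)]
    have hm₁ : (m₁ : ℚ) = 0 := by nlinarith [sq_nonneg (n₁ : ℚ)]
    have hn₁ : (n₁ : ℚ) = 0 := by nlinarith [sq_nonneg (n₁ : ℚ)]
    have e1 : m₁ = m₂ := by exact_mod_cast hm₁.trans hm₂.symm
    have e2 : n₁ = n₂ := by exact_mod_cast hn₁.trans hn₂.symm
    rw [e1, e2]
  · have h5 : (4 * ((m₂ : ℚ) + 16 * (n₂ : ℚ) ^ 2)) * ((m₁ : ℚ) + 25 * (n₁ : ℚ) ^ 2) =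
        (4 * ((m₂ : ℚ) + 16 * (n₂ : ℚ) ^ 2)) * ((m₂ : ℚ) + 25 * (n₂ : ℚ) ^ 2) := by
      linear_combination h4
    have hr : (m₁ : ℚ) + 25 * (n₁ : ℚ) ^ 2 = m₂ + 25 * (n₂ : ℚ) ^ 2 :=
      mul_left_cancel₀ (mul_ne_zero (by norm_num : (4:ℚ) ≠ 0) h0) h5
    have hn : (n₁ : ℚ) ^ 2 = (n₂ : ℚ) ^ 2 := by linarith
    have hn' : (n₁ : ℚ) = n₂ := by nlinarith
    have hm : (m₁ : ℚ) = m₂ := by rw [hn'] at hq; linarith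
    have e1 : m₁ = m₂ := by exact_mod_cast hm
    have e2 : n₁ = n₂ := by exact_mod_cast hn'
    rw [e1, e2]

/-- **THE REGULATOR DOOR (D1) as a theorem, modulo Tao–Ziegler.** For a prime `p ≥ 5`, `K ≥ 1`,
`m₁ ≡ 11 (mod 24)`, `p ∤ m₁`, `M ≥ 1` and `p^K ∤ m₁^{p-1} - 1`: there are infinitely many (pairwise
distinct Weierstrass models of) elliptic curves `E/ℚ` with `rank E(ℚ) = 2` for which Schneider's
conjecture holds at `p` for every canonical `p`-adic height datum. -/
theorem infinite_rankTwo_schneiderConjecture (hTZ : TaoZiegler2008_polynomialProgressions)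
    (hp5 : 5 ≤ p) {K m₁ M : ℕ} (hK : 0 < K) (hm₁ : m₁ % 24 = 11) (hpm₁ : ¬ p ∣ m₁) (hM : 0 < M)
    (hμ : ¬ (p : ℤ) ^ K ∣ (m₁ : ℤ) ^ (p - 1) - 1) :
    {W : WeierstrassCurve ℚ | W.IsElliptic ∧ W.mordellWeilRank = 2 ∧
      ∀ D : PAdicHeightData W p, D.IsCanonical → SchneiderConjecture D}.Infinite := by
  refine Set.infinite_of_injOn_mapsTo (f := fun q : ℕ × ℕ => zywinaCurve q.1 q.2)
    (zywinaCurve_injective.injOn) ?_ (zywinaClass_infinite hTZ hp.out hm₁ hpm₁ hM (K := K))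
  rintro ⟨m, n⟩ hq
  exact ⟨isElliptic_zywinaCurve hq.1, mordellWeilRank_zywinaCurve hq.1,
    fun D hD => schneiderConjecture_of_mem_zywinaClass hp5 hK hpm₁ hμ hq D hD⟩

/-- **The door at `p = 5`** (`K = 2`, `m₁ = 11`, `M = 1`: `11⁴ - 1 = 14640`, `25 ∤ 14640`):
infinitely many rank-`2` curves `E/ℚ` satisfying Schneider's conjecture at `5`, modulo
Tao–Ziegler. -/
theorem infinite_rankTwo_schneiderConjecture_at_five [Fact (Nat.Prime 5)]
    (hTZ : TaoZiegler2008_polynomialProgressions) :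
    {W : WeierstrassCurve ℚ | W.IsElliptic ∧ W.mordellWeilRank = 2 ∧
      ∀ D : PAdicHeightData W 5, D.IsCanonical → SchneiderConjecture D}.Infinite :=
  infinite_rankTwo_schneiderConjecture hTZ le_rfl (K := 2) (m₁ := 11) (M := 1) (by norm_num)
    (by norm_num) (by norm_num) (by norm_num) (by decide)

end Door

section IsoClasses

variable {p : ℕ} [hp : Fact p.Prime]

/-- **THE REGULATOR DOOR counted by `j`-invariant (`ℚ̄`-isomorphism classes).** For a prime `p ≥ 5`,
`K ≥ 1`, `m₁ ≡ 11 (mod 24)`, `p ∤ m₁`, `M ≥ 1` and `p^K ∤ m₁^{p-1} - 1`: the set of `j`-invariants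
`j ∈ ℚ` of elliptic curves `E/ℚ` with `rank E(ℚ) = 2` for which Schneider's conjecture holds at `p`
for every canonical `p`-adic height datum is infinite — distinct admissible pairs give distinct
`j`-invariants (`eq_of_j_eq`, Zywina 2025 Lemma 4.1), so the members of `zywinaClass p K m₁ M` are
pairwise non-isomorphic over `ℚ̄`. Modulo Tao–Ziegler only (referee R-12b form of
`infinite_rankTwo_schneiderConjecture`, which counts Weierstrass models). -/
theorem infinite_setOf_j_rankTwo_schneiderConjecture (hTZ : TaoZiegler2008_polynomialProgressions)
    (hp5 : 5 ≤ p) {K m₁ M : ℕ} (hK : 0 < K) (hm₁ : m₁ % 24 = 11) (hpm₁ : ¬ p ∣ m₁) (hM : 0 < M)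
    (hμ : ¬ (p : ℤ) ^ K ∣ (m₁ : ℤ) ^ (p - 1) - 1) :
    {j : ℚ | ∃ (W : WeierstrassCurve ℚ) (hW : W.IsElliptic),
      @WeierstrassCurve.j _ _ W hW = j ∧ W.mordellWeilRank = 2 ∧
      ∀ D : PAdicHeightData W p, D.IsCanonical → SchneiderConjecture D}.Infinite := by
  let f : ℕ × ℕ → ℚ := fun q =>
    if hq : ZywinaAdmissible q.1 q.2 then
      @WeierstrassCurve.j _ _ (zywinaCurve q.1 q.2) (isElliptic_zywinaCurve hq) else 0
  have hinj : Set.InjOn f (zywinaClass p K m₁ M) := by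
    rintro ⟨m, n⟩ h₁ ⟨m', n'⟩ h₂ he
    have h₁' : ZywinaAdmissible m n := h₁.1
    have h₂' : ZywinaAdmissible m' n' := h₂.1
    simp only [f, dif_pos h₁', dif_pos h₂'] at he
    obtain ⟨rfl, rfl⟩ := eq_of_j_eq h₁' h₂' he
    rfl
  refine Set.infinite_of_injOn_mapsTo hinj ?_
    (zywinaClass_infinite hTZ hp.out hm₁ hpm₁ hM (K := K))
  rintro ⟨m, n⟩ hq
  have hq' : ZywinaAdmissible m n := hq.1
  exact ⟨zywinaCurve m n, isElliptic_zywinaCurve hq', by simp only [f, dif_pos hq'],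
    mordellWeilRank_zywinaCurve hq',
    fun D hD => schneiderConjecture_of_mem_zywinaClass hp5 hK hpm₁ hμ hq D hD⟩

/-- **The door at `p = 5`, counted by `j`-invariant** (`K = 2`, `m₁ = 11`, `M = 1`;
`25 ∤ 11⁴ - 1 = 14640`): infinitely many `ℚ̄`-isomorphism classes (`j`-invariants) of rank-`2`
curves `E/ℚ` satisfying Schneider's conjecture at `5` for every canonical `5`-adic height datum,
modulo Tao–Ziegler (referee R-12b form of `infinite_rankTwo_schneiderConjecture_at_five`). -/
theorem infinite_setOf_j_rankTwo_schneiderConjecture_at_five [Fact (Nat.Prime 5)]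
    (hTZ : TaoZiegler2008_polynomialProgressions) :
    {j : ℚ | ∃ (W : WeierstrassCurve ℚ) (hW : W.IsElliptic),
      @WeierstrassCurve.j _ _ W hW = j ∧ W.mordellWeilRank = 2 ∧
      ∀ D : PAdicHeightData W 5, D.IsCanonical → SchneiderConjecture D}.Infinite :=
  infinite_setOf_j_rankTwo_schneiderConjecture hTZ le_rfl (K := 2) (m₁ := 11) (M := 1)
    (by norm_num) (by norm_num) (by norm_num) (by norm_num) (by decide)

end IsoClasses

end Summit.BirchSwinnertonDyer.Rank2
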